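import Summits.HodgeConjecture.HodgeConjecture.Theorems.VHCAbelianSchemesRoadTwistedDoorIso
import Summits.Ventures.HSemireg.AmplificationChainSigmaGluableOfSchemeIso
import HarnessLib

/-!
# Road b02 (`VHCAbelianSchemesRoad`, D-0059) — ISO-RESPECT OF THE TWISTED DOOR `AdmTw` modulo the σ_q-LEVEL statement alone
# (`hσ` of `VHCAbelianSchemesRoadTwistedDoorIso` discharged down to `IsISemiregularC` along `e^*`)

research route conditional on HC_CM; not a corollary; Q11.4-sentence-2 already refuted in dim ≥ 3.

FACT-FREE bookkeeping (seat ring2-b06 gen 118; ring2 LEAD gen 151 HOME INBOX l.4967 item (B) «σ-STACK HALF»; helper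
`--supports stmt-HodgeConjecture-19787 --as helper`; the crux skeleton v2 of record is untouched). Ring2-b02 gen 87's D2
(`VHCAbelianSchemesRoadTwistedDoorIso.lean`) reduced the displayed `h𝒪`/`hresp`/`htr` hypotheses of the crux's twisted door
`twistedReflexiveClass C AdmTw`, `AdmTw := gluableSigmaAdmissible ∨ bfSingleAdmissible`, to ONE notion-level statement `hσ` (pull-back
invariance of the venture's gluable σ-notion along isomorphisms of `ℂ`-schemes). The venture file
`AmplificationChainSigmaGluableOfSchemeIso.lean` (this seat) PROVES the `Ext^{<0} = 0` clause of that invariance (through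
`Literature.Algebra.Homology.mapDerivedCategory_isEquivalence`: `D(e^*)` is an equivalence) and the strictly-perfect data transport, and
REDUCES `hσ` to the σ_q-level statement `hσC` — Buchweitz–Flenner joint injectivity `Summit.Ventures.HSemireg.HomComplex.IsISemiregularC` along `e^*`, verbatim the
signature of the (missing) complex-level twin `HomComplex.IsISemiregularC.of_schemeIso` of the tree's module-level
`IsISemiregular.of_schemeIso`. THIS FILE composes: the three displayed-hypothesis theorems of D2 with `hσ` replaced by `hσC`
(`twistedDoor_respectsIso_of_isISemiregularC`, `secantAnchor_transport_of_isISemiregularC`,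
`design_on_self_of_designModLefschetzAt_tw_of_isISemiregularC`). One-liners; no new mathematics beyond the two files composed.

Nothing here says any cell, carrier statement, residual, K-SR♭∃, VHC, `HC_AV` or HC holds; `HC_CM` occurs nowhere; no statement of any
item is touched. References: [cite: BuchweitzFlenner2003, Def. 4.1 and §5 (I-semiregular)] [cite: Lieblich2006, Prop. 2.1.9]
[cite: Perry2026Semiregularity, Thm. 1.1 (hypotheses)] [cite: Bloch1972Semiregularity, Remark (7.5)].
-/

noncomputable section

open CategoryTheory CategoryTheory.Limits AlgebraicGeometry Topology
open AlgebraicGeometry.Scheme.Modules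

namespace Summit.HodgeConjecture.HodgeConjecture.Ring2.SemiregularRepresentatives

-- the cell's namespace repeats the summit name (`Summit.HodgeConjecture.HodgeConjecture…`), as in every `Ring2*` file
set_option linter.dupNamespace false

open Literature.AlgebraicGeometry Literature.AlgebraicGeometry.Motives Literature.AlgebraicGeometry.Modules
open Literature.AlgebraicGeometry.HodgeTheory
open Literature.AlgebraicGeometry.KTheory
open Literature.AlgebraicTopology.SingularHomology
open Literature.Barriers.HodgeConjecture (divisorClassesSpan)
open Summit.Ventures.HSemireg (gluableSigmaAdmissible gluableSigmaAdmissible_pullback_of_schemeIso_of_isISemiregularC)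

section Twisted

variable (C : ChernCharacterBetti)

/-- **The crux's twisted door `twistedReflexiveClass C AdmTw` RESPECTS ISOMORPHISMS of `ℂ`-schemes as soon as Buchweitz–Flenner joint
injectivity `IsISemiregularC` transports along pull-back by isomorphisms** (`hσC`, the σ_q-level statement; the `Ext^{<0} = 0` clause and
the strictly-perfect data are transported by the venture file, the BF half of `AdmTw` needs nothing). D2's `hσ` so discharged down to `hσC`.
[cite: BuchweitzFlenner2003, Def. 4.1 and §5 (I-semiregular)] [cite: Perry2026Semiregularity, Thm. 1.1 (hypotheses)] -/
theorem twistedDoor_respectsIso_of_isISemiregularC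
    (hσC : ∀ ⦃Y Y' : SchemeOver ℂ⦄ (e : Y' ≅ Y) (E : CochainComplex Y.left.Modules ℤ) (a b : ℤ)
      [E.IsStrictlyGE a] [E.IsStrictlyLE b] (hE : ∀ i, IsFiniteLocallyFree (E.X i)) (J : Set ℕ),
      letI := HasDerivedCategory.standard Y.left.Modules
      letI := HasDerivedCategory.standard Y'.left.Modules
      Summit.Ventures.HSemireg.HomComplex.IsISemiregularC Y E a b hE J →
        Summit.Ventures.HSemireg.HomComplex.IsISemiregularC Y' (((Scheme.Modules.pullback e.hom.left).mapHomologicalComplex _).obj E) a b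
          (fun i => (hE i).pullback e.hom.left) J) :
    ∀ (n : ℕ) ⦃Y Y' : SchemeOver ℂ⦄ (e : Y' ≅ Y) (I : Finset ℕ) (κ : (q : ℕ) → complexBetti Y (2 * q)),
      Literature.AlgebraicGeometry.HodgeTheory.twistedReflexiveClass C
          (fun n X₀ I E => Summit.Ventures.HSemireg.gluableSigmaAdmissible n X₀ I E ∨
            Literature.AlgebraicGeometry.HodgeTheory.bfSingleAdmissible n X₀ I E) n Y I κ →
        Literature.AlgebraicGeometry.HodgeTheory.twistedReflexiveClass C
          (fun n X₀ I E => Summit.Ventures.HSemireg.gluableSigmaAdmissible n X₀ I E ∨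
            Literature.AlgebraicGeometry.HodgeTheory.bfSingleAdmissible n X₀ I E) n Y' I
          (fun q ↦ complexBetti.map e.hom (2 * q) (κ q)) :=
  twistedDoor_respectsIso_of_sigmaPullback C (gluableSigmaAdmissible_pullback_of_schemeIso_of_isISemiregularC hσC)

/-- **L3's transport of the secant-anchor data with `hresp` reduced to `hσC`** (σ_q-level): `θ ∈` secant anchors of `X` and `w` served there
give `e.inv^*θ ∈` secant anchors of `X'` and `e.inv^*w` served there, for `e : X ≅ X'`. [folklore] [cite: HatcherAT2002, Prop. 3.10] -/
theorem secantAnchor_transport_of_isISemiregularC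
    (hσC : ∀ ⦃Y Y' : SchemeOver ℂ⦄ (e : Y' ≅ Y) (E : CochainComplex Y.left.Modules ℤ) (a b : ℤ)
      [E.IsStrictlyGE a] [E.IsStrictlyLE b] (hE : ∀ i, IsFiniteLocallyFree (E.X i)) (J : Set ℕ),
      letI := HasDerivedCategory.standard Y.left.Modules
      letI := HasDerivedCategory.standard Y'.left.Modules
      Summit.Ventures.HSemireg.HomComplex.IsISemiregularC Y E a b hE J →
        Summit.Ventures.HSemireg.HomComplex.IsISemiregularC Y' (((Scheme.Modules.pullback e.hom.left).mapHomologicalComplex _).obj E) a b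
          (fun i => (hE i).pullback e.hom.left) J) :
    ∀ ⦃X X' : SchemeOver ℂ⦄ (e : X ≅ X') (θ : complexBetti X 2) (w : complexBetti X (2 * 3)),
      θ ∈ secantAnchorSixfold C X → w ∈ secantServedClasses C X θ →
        complexBetti.map e.inv 2 θ ∈ secantAnchorSixfold C X' ∧
          complexBetti.map e.inv (2 * 3) w ∈ secantServedClasses C X' (complexBetti.map e.inv 2 θ) :=
  secantAnchor_transport_of_sigmaPullback C (gluableSigmaAdmissible_pullback_of_schemeIso_of_isISemiregularC hσC)

/-- **PART Z-c's design-on-self for the TWISTED door with `h𝒪` reduced to `hσC`** (σ_q-level).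
[cite: Bloch1972Semiregularity, Remark (7.5)] [cite: Perry2026Semiregularity, Thm. 1.1 (hypotheses)] -/
theorem design_on_self_of_designModLefschetzAt_tw_of_isISemiregularC
    (hσC : ∀ ⦃Y Y' : SchemeOver ℂ⦄ (e : Y' ≅ Y) (E : CochainComplex Y.left.Modules ℤ) (a b : ℤ)
      [E.IsStrictlyGE a] [E.IsStrictlyLE b] (hE : ∀ i, IsFiniteLocallyFree (E.X i)) (J : Set ℕ),
      letI := HasDerivedCategory.standard Y.left.Modules
      letI := HasDerivedCategory.standard Y'.left.Modules
      Summit.Ventures.HSemireg.HomComplex.IsISemiregularC Y E a b hE J →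
        Summit.Ventures.HSemireg.HomComplex.IsISemiregularC Y' (((Scheme.Modules.pullback e.hom.left).mapHomologicalComplex _).obj E) a b
          (fun i => (hE i).pullback e.hom.left) J)
    {n p : ℕ} (h : DesignModLefschetzAt (Literature.AlgebraicGeometry.HodgeTheory.twistedReflexiveClass C
      (fun n X₀ I E => Summit.Ventures.HSemireg.gluableSigmaAdmissible n X₀ I E ∨
        Literature.AlgebraicGeometry.HodgeTheory.bfSingleAdmissible n X₀ I E)) n p)
    (X : SchemeOver ℂ) (hX : ∃ A : AbelianVariety ℂ, A.dim = n ∧ Nonempty (A.X ≅ X))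
    (w : complexBetti X (2 * p)) (hwQ : IsRationalClass w) (hwalg : w ∈ algebraicClasses X p) (hwD : w ∉ divisorClassesSpan X n p) :
    ∃ (I : Finset ℕ) (κ : (q : ℕ) → complexBetti X (2 * q)) (a : ℂ) (z : complexBetti X (2 * p)),
      p ∈ I ∧ Literature.AlgebraicGeometry.HodgeTheory.twistedReflexiveClass C
        (fun n X₀ I E => Summit.Ventures.HSemireg.gluableSigmaAdmissible n X₀ I E ∨
          Literature.AlgebraicGeometry.HodgeTheory.bfSingleAdmissible n X₀ I E) n X I κ ∧
      a ≠ 0 ∧ z ∈ algebraicClasses X p ∧ z ∈ divisorClassesSpan X n p ∧ κ p = a • w + z ∧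
      ∀ q ∈ I, IsOfHodgeType n X (2 * q) q q (κ q) :=
  design_on_self_of_designModLefschetzAt_tw_of_sigmaPullback C
    (gluableSigmaAdmissible_pullback_of_schemeIso_of_isISemiregularC hσC) h X hX w hwQ hwalg hwD

end Twisted

end Summit.HodgeConjecture.HodgeConjecture.Ring2.SemiregularRepresentatives

end
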